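import Summits.HodgeConjecture.CorCM.MultiFieldWeilDihedralDecics
import Summits.HodgeConjecture.CorCM.MultiFieldWeilUnitsMenuGrouped
import HarnessLib

/-!
# MULTI-FIELD WEIL ENGINE — DIHEDRAL DECIC FIELDS, GROUPED BY FIELD: the CM curve `E` and, over each of finitely many decic CM fields `K_j ∋ k` with DIHEDRAL quintic part,
# up to two fivefolds `B_{j,t} ⊨ (K_j; Ψ_{j,t})` of `k`-signature `(2,3)` — the Hodge conjecture for every product of copies, given only Markman's hyperbolic-sixfold theorem

Cell `pub-hodgecm2` (COR-CM), seat b30 gen 42 (2026-08-26); count-neutral own lane MULTI-FIELD WEIL ENGINE (stem `MultiFieldWeil*`), the user-facing GROUPED form of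
`CorCM/MultiFieldWeilDihedralDecics.lean` (`hodgeConjectureFor_biproduct_comp_of_dihedralDecics`, slots `is : Fin r → I`), obtained exactly as U7
(`CorCM/MultiFieldWeilUnitsMenuGrouped.lean`) is obtained from U6: enumerate the structures `(j, t)`, fields `Option.elim · k K_j` with their instances, `exists_realisations_cons_of`.
Theorems only; no definition, no named fact, no `sorry`.  HONEST FRAMING: conditional ONLY on the displayed Markman binder `hM6`; `HC_CM` is NOT proved and not asserted.

**`hodgeConjectureFor_biproduct_sigma_of_dihedralDecics`.**  `k` imaginary quadratic with `E ⊨ (k; {τ})`; finitely many DECIC CM fields `K_j ⊇ iK j (k)` with Galois closure of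
degree `≤ 20` in `ℂ` and a `τ`-embedding taking a value outside the image of another (`K_j = k·K_j⁺`, `K_j⁺` a real quintic field with DIHEDRAL Galois group: the image on the
five `τ`-embeddings is `D₅`, NOT `2`-transitive); over each `K_j` at most two structures `B_{j,t} ⊨ (K_j; Ψ_{j,t})` (`t < c_j ≤ 2`) with exactly two members of `Ψ_{j,t}` over `τ`;
FREENESS: an automorphism of `ℂ` over `τ(k)` stabilising, on the `τ`-embeddings, every `Ψ_{j,t}` (`t < c_j`) fixes every `τ`-embedding of `K_j` — for `c_j = 1` automatic over a
dihedral field, for `c_j = 2` it says the two `2`-sets of `τ`-embeddings have DIFFERENT AXES on the pentagon (`{a,b} ≠ {a',b'}`, `a + b ≠ a' + b'`; e.g. they share a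
`τ`-embedding); `Hom(K_{j'}, K_j) = ∅` for `j' ≠ j`.  THEN the Hodge conjecture holds for `⨁_l X_l`, every `X_l ∈ {E} ∪ {B_{j,t}}`, and (dominated form) for everything dominated
by such a product.  READING (with `…CommutantNoGo`, `…DihedralFiveCriterion`): over a dihedral decic field the units method yields EXACTLY the pairs of `(2,3)`-classes with
different axes — two classes, never three; over a cyclic one, one class.
[cite: Markman2025SecantWeil, Thm 1.5.1] [cite: Shimura1998, §6.1 Corollary of Theorem 2, §8.4, §18.2 Lemma (i)] [cite: DixonMortimer1996, §1.4 Ex. 1.4.1–1.4.2; §1.6, Thm. 1.6A;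
§2.1; §3.3] [cite: Serre1977, §5.3] [cite: Lang2002, VI §1 Thm. 1.1 and V §2 Thm. 2.8; XIII §4] [cite: MumfordAV1970, §19]

## References
* [Markman2025SecantWeil] E. Markman, Cycles on abelian 2n-folds of Weil type from secant sheaves on abelian n-folds, Thm 1.5.1.  [Shimura1998] G. Shimura, *Abelian varieties with
  complex multiplication and modular functions*, §6.1, §8.4, §18.2.  [DixonMortimer1996] J. D. Dixon, B. Mortimer, *Permutation Groups*, GTM 163.  [Serre1977] J.-P. Serre,
  *Linear Representations of Finite Groups*, GTM 42, §5.3.  [Lang2002] S. Lang, *Algebra*, GTM 211, V §2, VI §1, XIII §4.  [MumfordAV1970] D. Mumford, *Abelian Varieties*, §19.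
-/

noncomputable section

open CategoryTheory CategoryTheory.Limits NumberField IntermediateField

namespace Summit.HodgeConjecture.CorCM.MultiFieldWeil

open Finset
open Literature.AlgebraicGeometry Literature.AlgebraicGeometry.Motives Literature.AlgebraicGeometry.HodgeTheory
open Literature.AlgebraicGeometry.ComplexMultiplication (IsCMTypeRealisation)
open Literature.AlgebraicTopology.SingularHomology
open Literature.NumberTheory.ComplexMultiplication

open scoped Classical

section Grouped

variable {J : Type} [Fintype J] {KJ : J → Type} [fK : ∀ j, Field (KJ j)] [nK : ∀ j, NumberField (KJ j)] [cK : ∀ j, IsCMField (KJ j)]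
  {k : Type} [fk : Field k] [nk : NumberField k] [ck : IsCMField k] {τ : k →+* ℂ} {c : J → ℕ}
  {B : ∀ j : J, Fin (c j) → AbelianVariety ℂ} {Ψ : ∀ j : J, Fin (c j) → CMType (KJ j)}
  {ιB : ∀ (j : J) (t : Fin (c j)), 𝓞 (KJ j) →+* End (B j t)} {θB : ∀ (j : J) (t : Fin (c j)), KJ j →+* Module.End ℂ (complexBetti (B j t).X 1)}
  {E : AbelianVariety ℂ} {Φ₀ : CMType k} {ιE : 𝓞 k →+* End E} {θE : k →+* Module.End ℂ (complexBetti E.X 1)}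

/-- **UP TO TWO `(2,3)`-FIVEFOLDS OVER EACH OF SEVERAL DIHEDRAL DECIC CM FIELDS THROUGH `k`, GROUPED BY FIELD, TIMES THE CM CURVE — GIVEN ONLY MARKMAN'S
HYPERBOLIC-SIXFOLD THEOREM.**  See the module docstring.  `HC_CM` is NOT asserted. [cite: Markman2025SecantWeil, Thm 1.5.1] [cite: Shimura1998, §6.1 Corollary of Theorem 2,
§8.4, §18.2] [cite: DixonMortimer1996, §1.6, Thm. 1.6A; §2.1; §3.3] [cite: Serre1977, §5.3] [cite: Lang2002, VI §1 Thm. 1.1; XIII §4] -/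
theorem hodgeConjectureFor_biproduct_sigma_of_dihedralDecics (hM6 : Markman2025_weilClasses_algebraic_hyperbolicSixfold)
    (h2 : Module.finrank ℚ k = 2) (iK : ∀ j : J, k →+* KJ j) (hdeg : ∀ j, Module.finrank ℚ (KJ j) = 10)
    (hB : ∀ j t, IsCMTypeRealisation (Ψ j t) (B j t) (ιB j t) (θB j t)) (hE : IsCMTypeRealisation Φ₀ E ιE θE) (hΦ₀ : ∀ σ : k →+* ℂ, σ ∈ Φ₀.1 ↔ σ = τ)
    (hcnt : ∀ j t, (Finset.univ.filter fun s : KJ j →+* ℂ => s.comp (iK j) = τ ∧ s ∈ (Ψ j t).1).card = 2) (hc : ∀ j, c j ≤ 2)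
    (h20 : ∀ j, Module.finrank ℚ ↥(normalClosure ℚ (KJ j) ℂ) ≤ 20)
    (hns : ∀ j, ∃ s₀ t₀ : KJ j →+* ℂ, s₀.comp (iK j) = τ ∧ t₀.comp (iK j) = τ ∧ ∃ x, t₀ x ∉ adjoin ℚ (Set.range s₀))
    (hfree : ∀ (j : J) (ρ : ℂ ≃+* ℂ), (ρ : ℂ →+* ℂ).comp τ = τ →
      (∀ (t : Fin (c j)) (s : KJ j →+* ℂ), s.comp (iK j) = τ → (s ∈ (Ψ j t).1 ↔ (ρ : ℂ →+* ℂ).comp s ∈ (Ψ j t).1)) →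
      ∀ s : KJ j →+* ℂ, s.comp (iK j) = τ → (ρ : ℂ →+* ℂ).comp s = s)
    (hiso : ∀ j j' : J, j' ≠ j → IsEmpty (KJ j' →+* KJ j))
    {N : ℕ} (κ : Fin N → Option ((j : J) × Fin (c j))) :
    HodgeConjectureFor (⨁ fun l => ((κ l).elim E fun x => B x.1 x.2 : AbelianVariety ℂ)).dim (⨁ fun l => ((κ l).elim E fun x => B x.1 x.2 : AbelianVariety ℂ)).X := by
  -- enumerate the structures
  let S : Type := (j : J) × Fin (c j)
  let σ : Fin (Fintype.card S) ≃ S := (Fintype.equivFin S).symm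
  -- the fields `Option.elim · k KJ` with their instances (U7's pattern)
  let Kf : Option J → Type := fun o => o.elim k KJ
  letI instF : ∀ o, Field (Kf o) := fun o => @Option.rec J (fun o => Field (Option.elim o k KJ)) fk (fun j => fK j) o
  letI instN : ∀ o, NumberField (Kf o) := fun o => @Option.rec J (fun o => NumberField (Option.elim o k KJ)) nk (fun j => nK j) o
  haveI instC : ∀ o, IsCMField (Kf o) := fun o => @Option.rec J (fun o => IsCMField (Option.elim o k KJ)) ck (fun j => cK j) o
  let is : Fin (Fintype.card S) → Option J := fun m => some (σ m).1
  let iK' : ∀ o : Option J, Kf none →+* Kf o := fun o => @Option.rec J (fun o => k →+* Option.elim o k KJ) (RingHom.id k) (fun j => iK j) o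
  obtain ⟨Φ', ι', θ', hA', h0, hQ⟩ := exists_realisations_cons_of (Kf := Kf) (i₀ := none) (is := is) (T := fun m => B (σ m).1 (σ m).2)
    (ΦT := fun m => Ψ (σ m).1 (σ m).2) (ιT := fun m => ιB (σ m).1 (σ m).2) (θT := fun m => θB (σ m).1 (σ m).2) (Ψ := Φ₀) (E := E) (ιE := ιE) (θE := θE) hE
    (fun m => hB (σ m).1 (σ m).2) (fun m Φ'' => Φ'' = Ψ (σ m).1 (σ m).2) (fun m => rfl)
  have hΨ' : ∀ s : Kf none →+* ℂ, s ∈ (Φ' 0).1 ↔ s = τ := by rw [h0]; exact hΦ₀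
  -- the fibre of a slot maps injectively into `Fin (c j)`
  have hfib : ∀ m₀ : Fin (Fintype.card S), ∃ f : {m // is m = is m₀} → Fin (c (σ m₀).1), Function.Injective f := by
    intro m₀
    refine ⟨fun m => Fin.cast (congrArg c (Option.some.inj m.2)) (σ m.1).2, fun m m' hmm => ?_⟩
    have h1 : (σ m.1).1 = (σ m'.1).1 := (Option.some.inj m.2).trans (Option.some.inj m'.2).symm
    have h2 : HEq (σ m.1).2 (σ m'.1).2 := (Fin.heq_ext_iff (congrArg c h1)).2 (by simpa only [Fin.val_cast] using congrArg Fin.val hmm)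
    exact Subtype.ext (σ.injective (Sigma.ext h1 h2))
  have hfib2 : ∀ m₀ : Fin (Fintype.card S), (Finset.univ.filter fun m : Fin (Fintype.card S) => is m = is m₀).card ≤ 2 := by
    intro m₀
    obtain ⟨f, hf⟩ := hfib m₀
    have h1 := Fintype.card_le_of_injective f hf
    rw [Fintype.card_fin, Fintype.card_subtype] at h1
    exact h1.trans (hc _)
  -- the comp form for the enumerated family
  have key : HodgeConjectureFor
      (⨁ fun l => (Fin.cons E (fun m => B (σ m).1 (σ m).2) : Fin (Fintype.card S + 1) → AbelianVariety ℂ) ((κ l).elim 0 fun x => (σ.symm x).succ)).dim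
      (⨁ fun l => (Fin.cons E (fun m => B (σ m).1 (σ m).2) : Fin (Fintype.card S + 1) → AbelianVariety ℂ) ((κ l).elim 0 fun x => (σ.symm x).succ)).X :=
    hodgeConjectureFor_biproduct_comp_of_dihedralDecics (Kf := Kf) (i₀ := none) (is := is) hM6
      (fun l => (κ l).elim 0 fun x => (σ.symm x).succ) h2 (fun m => hdeg (σ m).1) iK' hA' hΨ'
      (fun m => by rw [hQ m]; exact hcnt (σ m).1 (σ m).2) (fun m => by convert hfib2 m using 4) (fun m => h20 (σ m).1) (fun m => hns (σ m).1)
      (fun m ρ hρτ H s hs => hfree (σ m).1 ρ hρτ (fun t s' hs' => by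
        have hkey : ∀ x : S, some x.1 = is m → ∀ u : KJ x.1 →+* ℂ, u.comp (iK x.1) = τ →
            (u ∈ (Ψ x.1 x.2).1 ↔ (ρ : ℂ →+* ℂ).comp u ∈ (Ψ x.1 x.2).1) := by
          intro x hx
          have hx' : is (σ.symm x) = is m := by simp only [is, Equiv.apply_symm_apply]; exact hx
          have H1 := H (σ.symm x) hx'
          rw [hQ (σ.symm x)] at H1
          change ∀ u : KJ (σ (σ.symm x)).1 →+* ℂ, u.comp (iK (σ (σ.symm x)).1) = τ →
            (u ∈ (Ψ (σ (σ.symm x)).1 (σ (σ.symm x)).2).1 ↔ (ρ : ℂ →+* ℂ).comp u ∈ (Ψ (σ (σ.symm x)).1 (σ (σ.symm x)).2).1) at H1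
          rw [Equiv.apply_symm_apply] at H1
          exact H1
        exact hkey ⟨(σ m).1, t⟩ rfl s' hs') s hs)
      (fun m₀ m hne => hiso (σ m₀).1 (σ m).1 (fun h => hne (congrArg some h)))
  -- the two families of factors agree
  have hfam : (fun l => (Fin.cons E (fun m => B (σ m).1 (σ m).2) : Fin (Fintype.card S + 1) → AbelianVariety ℂ) ((κ l).elim 0 fun x => (σ.symm x).succ)) =
      fun l => ((κ l).elim E fun x => B x.1 x.2 : AbelianVariety ℂ) := by
    funext l
    rcases hκ : κ l with _ | x
    · rfl
    · show (Fin.cons E (fun m => B (σ m).1 (σ m).2) : Fin (Fintype.card S + 1) → AbelianVariety ℂ) (σ.symm x).succ = B x.1 x.2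
      rw [Fin.cons_succ]
      exact congrArg (fun y : S => B y.1 y.2) (σ.apply_symm_apply x)
  rw [hfam] at key
  exact key

/-- **Dominated form** (anything dominated by such a product of copies; isogenous varieties in particular). [cite: Markman2025SecantWeil, Thm 1.5.1] [cite: MumfordAV1970, §19] -/
theorem hodgeConjectureFor_of_avDominatedBy_sigma_of_dihedralDecics (hM6 : Markman2025_weilClasses_algebraic_hyperbolicSixfold)
    (h2 : Module.finrank ℚ k = 2) (iK : ∀ j : J, k →+* KJ j) (hdeg : ∀ j, Module.finrank ℚ (KJ j) = 10)
    (hB : ∀ j t, IsCMTypeRealisation (Ψ j t) (B j t) (ιB j t) (θB j t)) (hE : IsCMTypeRealisation Φ₀ E ιE θE) (hΦ₀ : ∀ σ : k →+* ℂ, σ ∈ Φ₀.1 ↔ σ = τ)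
    (hcnt : ∀ j t, (Finset.univ.filter fun s : KJ j →+* ℂ => s.comp (iK j) = τ ∧ s ∈ (Ψ j t).1).card = 2) (hc : ∀ j, c j ≤ 2)
    (h20 : ∀ j, Module.finrank ℚ ↥(normalClosure ℚ (KJ j) ℂ) ≤ 20)
    (hns : ∀ j, ∃ s₀ t₀ : KJ j →+* ℂ, s₀.comp (iK j) = τ ∧ t₀.comp (iK j) = τ ∧ ∃ x, t₀ x ∉ adjoin ℚ (Set.range s₀))
    (hfree : ∀ (j : J) (ρ : ℂ ≃+* ℂ), (ρ : ℂ →+* ℂ).comp τ = τ →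
      (∀ (t : Fin (c j)) (s : KJ j →+* ℂ), s.comp (iK j) = τ → (s ∈ (Ψ j t).1 ↔ (ρ : ℂ →+* ℂ).comp s ∈ (Ψ j t).1)) →
      ∀ s : KJ j →+* ℂ, s.comp (iK j) = τ → (ρ : ℂ →+* ℂ).comp s = s)
    (hiso : ∀ j j' : J, j' ≠ j → IsEmpty (KJ j' →+* KJ j))
    {N : ℕ} (κ : Fin N → Option ((j : J) × Fin (c j))) {X : AbelianVariety ℂ}
    (hX : Domination.AVDominatedBy X (⨁ fun l => ((κ l).elim E fun x => B x.1 x.2 : AbelianVariety ℂ))) : HodgeConjectureFor X.dim X.X :=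
  Domination.hodgeConjectureFor_of_avDominatedBy
    (hodgeConjectureFor_biproduct_sigma_of_dihedralDecics hM6 h2 iK hdeg hB hE hΦ₀ hcnt hc h20 hns hfree hiso κ) hX

/-! ## The grouped menu with freeness asked only of the fields carrying two structures -/

/-- **THE GROUPED MENU WITH FREENESS ASKED ONLY OF THE FIELDS CARRYING TWO STRUCTURES** — the form to use.  CORRECTION of the informal remark «for `c_j = 1` automatic» in the
module docstring: for a field with ONE structure the hypothesis `hfree j` of `hodgeConjectureFor_biproduct_sigma_of_dihedralDecics` is UNSATISFIABLE (the axis reflection of the type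
stabilises it and moves τ-embeddings), so that theorem silently excludes fields with `c_j = 1`; here `hfree j` is asked only when `1 < c_j` — a single structure over a dihedral
(indeed any) decic field is a prime slot and needs nothing.  From `hodgeConjectureFor_biproduct_comp_of_dihedralDecics'`. [cite: Markman2025SecantWeil, Thm 1.5.1] [cite: Shimura1998,
§6.1 Corollary of Theorem 2, §8.4, §18.2] [cite: DixonMortimer1996, §1.6, Thm. 1.6A; §2.1; §3.3] [cite: Serre1977, §5.3] [cite: Lang2002, VI §1 Thm. 1.1; XIII §4] -/
theorem hodgeConjectureFor_biproduct_sigma_of_dihedralDecics' (hM6 : Markman2025_weilClasses_algebraic_hyperbolicSixfold)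
    (h2 : Module.finrank ℚ k = 2) (iK : ∀ j : J, k →+* KJ j) (hdeg : ∀ j, Module.finrank ℚ (KJ j) = 10)
    (hB : ∀ j t, IsCMTypeRealisation (Ψ j t) (B j t) (ιB j t) (θB j t)) (hE : IsCMTypeRealisation Φ₀ E ιE θE) (hΦ₀ : ∀ σ : k →+* ℂ, σ ∈ Φ₀.1 ↔ σ = τ)
    (hcnt : ∀ j t, (Finset.univ.filter fun s : KJ j →+* ℂ => s.comp (iK j) = τ ∧ s ∈ (Ψ j t).1).card = 2) (hc : ∀ j, c j ≤ 2)
    (h20 : ∀ j, Module.finrank ℚ ↥(normalClosure ℚ (KJ j) ℂ) ≤ 20)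
    (hns : ∀ j, ∃ s₀ t₀ : KJ j →+* ℂ, s₀.comp (iK j) = τ ∧ t₀.comp (iK j) = τ ∧ ∃ x, t₀ x ∉ adjoin ℚ (Set.range s₀))
    (hfree : ∀ j : J, 1 < c j → ∀ ρ : ℂ ≃+* ℂ, (ρ : ℂ →+* ℂ).comp τ = τ →
      (∀ (t : Fin (c j)) (s : KJ j →+* ℂ), s.comp (iK j) = τ → (s ∈ (Ψ j t).1 ↔ (ρ : ℂ →+* ℂ).comp s ∈ (Ψ j t).1)) →
      ∀ s : KJ j →+* ℂ, s.comp (iK j) = τ → (ρ : ℂ →+* ℂ).comp s = s)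
    (hiso : ∀ j j' : J, j' ≠ j → IsEmpty (KJ j' →+* KJ j))
    {N : ℕ} (κ : Fin N → Option ((j : J) × Fin (c j))) :
    HodgeConjectureFor (⨁ fun l => ((κ l).elim E fun x => B x.1 x.2 : AbelianVariety ℂ)).dim (⨁ fun l => ((κ l).elim E fun x => B x.1 x.2 : AbelianVariety ℂ)).X := by
  -- enumerate the structures
  let S : Type := (j : J) × Fin (c j)
  let σ : Fin (Fintype.card S) ≃ S := (Fintype.equivFin S).symm
  -- the fields `Option.elim · k KJ` with their instances (U7's pattern)
  let Kf : Option J → Type := fun o => o.elim k KJ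
  letI instF : ∀ o, Field (Kf o) := fun o => @Option.rec J (fun o => Field (Option.elim o k KJ)) fk (fun j => fK j) o
  letI instN : ∀ o, NumberField (Kf o) := fun o => @Option.rec J (fun o => NumberField (Option.elim o k KJ)) nk (fun j => nK j) o
  haveI instC : ∀ o, IsCMField (Kf o) := fun o => @Option.rec J (fun o => IsCMField (Option.elim o k KJ)) ck (fun j => cK j) o
  let is : Fin (Fintype.card S) → Option J := fun m => some (σ m).1
  let iK' : ∀ o : Option J, Kf none →+* Kf o := fun o => @Option.rec J (fun o => k →+* Option.elim o k KJ) (RingHom.id k) (fun j => iK j) o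
  obtain ⟨Φ', ι', θ', hA', h0, hQ⟩ := exists_realisations_cons_of (Kf := Kf) (i₀ := none) (is := is) (T := fun m => B (σ m).1 (σ m).2)
    (ΦT := fun m => Ψ (σ m).1 (σ m).2) (ιT := fun m => ιB (σ m).1 (σ m).2) (θT := fun m => θB (σ m).1 (σ m).2) (Ψ := Φ₀) (E := E) (ιE := ιE) (θE := θE) hE
    (fun m => hB (σ m).1 (σ m).2) (fun m Φ'' => Φ'' = Ψ (σ m).1 (σ m).2) (fun m => rfl)
  have hΨ' : ∀ s : Kf none →+* ℂ, s ∈ (Φ' 0).1 ↔ s = τ := by rw [h0]; exact hΦ₀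
  -- the fibre of a slot maps injectively into `Fin (c j)`
  have hfib : ∀ m₀ : Fin (Fintype.card S), ∃ f : {m // is m = is m₀} → Fin (c (σ m₀).1), Function.Injective f := by
    intro m₀
    refine ⟨fun m => Fin.cast (congrArg c (Option.some.inj m.2)) (σ m.1).2, fun m m' hmm => ?_⟩
    have h1 : (σ m.1).1 = (σ m'.1).1 := (Option.some.inj m.2).trans (Option.some.inj m'.2).symm
    have h2 : HEq (σ m.1).2 (σ m'.1).2 := (Fin.heq_ext_iff (congrArg c h1)).2 (by simpa only [Fin.val_cast] using congrArg Fin.val hmm)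
    exact Subtype.ext (σ.injective (Sigma.ext h1 h2))
  have hfib2 : ∀ m₀ : Fin (Fintype.card S), (Finset.univ.filter fun m : Fin (Fintype.card S) => is m = is m₀).card ≤ 2 := by
    intro m₀
    obtain ⟨f, hf⟩ := hfib m₀
    have h1 := Fintype.card_le_of_injective f hf
    rw [Fintype.card_fin, Fintype.card_subtype] at h1
    exact h1.trans (hc _)
  -- the comp form for the enumerated family
  have key : HodgeConjectureFor
      (⨁ fun l => (Fin.cons E (fun m => B (σ m).1 (σ m).2) : Fin (Fintype.card S + 1) → AbelianVariety ℂ) ((κ l).elim 0 fun x => (σ.symm x).succ)).dim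
      (⨁ fun l => (Fin.cons E (fun m => B (σ m).1 (σ m).2) : Fin (Fintype.card S + 1) → AbelianVariety ℂ) ((κ l).elim 0 fun x => (σ.symm x).succ)).X :=
    hodgeConjectureFor_biproduct_comp_of_dihedralDecics' (Kf := Kf) (i₀ := none) (is := is) hM6
      (fun l => (κ l).elim 0 fun x => (σ.symm x).succ) h2 (fun m => hdeg (σ m).1) iK' hA' hΨ'
      (fun m => by rw [hQ m]; exact hcnt (σ m).1 (σ m).2) (fun m => by convert hfib2 m using 4) (fun m => h20 (σ m).1) (fun m => hns (σ m).1)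
      (fun m hm ρ hρτ H s hs => hfree (σ m).1 (by
          obtain ⟨m', hne, heq⟩ := hm
          obtain ⟨f, hf⟩ := hfib m
          have h2c : ({f ⟨m, rfl⟩, f ⟨m', heq⟩} : Finset (Fin (c (σ m).1))).card = 2 := Finset.card_pair fun h => hne (congrArg Subtype.val (hf h)).symm
          have := Finset.card_le_univ ({f ⟨m, rfl⟩, f ⟨m', heq⟩} : Finset (Fin (c (σ m).1)))
          rw [h2c, Fintype.card_fin] at this
          omega) ρ hρτ (fun t s' hs' => by
        have hkey : ∀ x : S, some x.1 = is m → ∀ u : KJ x.1 →+* ℂ, u.comp (iK x.1) = τ →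
            (u ∈ (Ψ x.1 x.2).1 ↔ (ρ : ℂ →+* ℂ).comp u ∈ (Ψ x.1 x.2).1) := by
          intro x hx
          have hx' : is (σ.symm x) = is m := by simp only [is, Equiv.apply_symm_apply]; exact hx
          have H1 := H (σ.symm x) hx'
          rw [hQ (σ.symm x)] at H1
          change ∀ u : KJ (σ (σ.symm x)).1 →+* ℂ, u.comp (iK (σ (σ.symm x)).1) = τ →
            (u ∈ (Ψ (σ (σ.symm x)).1 (σ (σ.symm x)).2).1 ↔ (ρ : ℂ →+* ℂ).comp u ∈ (Ψ (σ (σ.symm x)).1 (σ (σ.symm x)).2).1) at H1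
          rw [Equiv.apply_symm_apply] at H1
          exact H1
        exact hkey ⟨(σ m).1, t⟩ rfl s' hs') s hs)
      (fun m₀ m hne => hiso (σ m₀).1 (σ m).1 (fun h => hne (congrArg some h)))
  -- the two families of factors agree
  have hfam : (fun l => (Fin.cons E (fun m => B (σ m).1 (σ m).2) : Fin (Fintype.card S + 1) → AbelianVariety ℂ) ((κ l).elim 0 fun x => (σ.symm x).succ)) =
      fun l => ((κ l).elim E fun x => B x.1 x.2 : AbelianVariety ℂ) := by
    funext l
    rcases hκ : κ l with _ | x
    · rfl
    · show (Fin.cons E (fun m => B (σ m).1 (σ m).2) : Fin (Fintype.card S + 1) → AbelianVariety ℂ) (σ.symm x).succ = B x.1 x.2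
      rw [Fin.cons_succ]
      exact congrArg (fun y : S => B y.1 y.2) (σ.apply_symm_apply x)
  rw [hfam] at key
  exact key

/-- **Dominated form** of the primed grouped menu. [cite: Markman2025SecantWeil, Thm 1.5.1] [cite: MumfordAV1970, §19] -/
theorem hodgeConjectureFor_of_avDominatedBy_sigma_of_dihedralDecics' (hM6 : Markman2025_weilClasses_algebraic_hyperbolicSixfold)
    (h2 : Module.finrank ℚ k = 2) (iK : ∀ j : J, k →+* KJ j) (hdeg : ∀ j, Module.finrank ℚ (KJ j) = 10)
    (hB : ∀ j t, IsCMTypeRealisation (Ψ j t) (B j t) (ιB j t) (θB j t)) (hE : IsCMTypeRealisation Φ₀ E ιE θE) (hΦ₀ : ∀ σ : k →+* ℂ, σ ∈ Φ₀.1 ↔ σ = τ)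
    (hcnt : ∀ j t, (Finset.univ.filter fun s : KJ j →+* ℂ => s.comp (iK j) = τ ∧ s ∈ (Ψ j t).1).card = 2) (hc : ∀ j, c j ≤ 2)
    (h20 : ∀ j, Module.finrank ℚ ↥(normalClosure ℚ (KJ j) ℂ) ≤ 20)
    (hns : ∀ j, ∃ s₀ t₀ : KJ j →+* ℂ, s₀.comp (iK j) = τ ∧ t₀.comp (iK j) = τ ∧ ∃ x, t₀ x ∉ adjoin ℚ (Set.range s₀))
    (hfree : ∀ j : J, 1 < c j → ∀ ρ : ℂ ≃+* ℂ, (ρ : ℂ →+* ℂ).comp τ = τ →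
      (∀ (t : Fin (c j)) (s : KJ j →+* ℂ), s.comp (iK j) = τ → (s ∈ (Ψ j t).1 ↔ (ρ : ℂ →+* ℂ).comp s ∈ (Ψ j t).1)) →
      ∀ s : KJ j →+* ℂ, s.comp (iK j) = τ → (ρ : ℂ →+* ℂ).comp s = s)
    (hiso : ∀ j j' : J, j' ≠ j → IsEmpty (KJ j' →+* KJ j))
    {N : ℕ} (κ : Fin N → Option ((j : J) × Fin (c j))) {X : AbelianVariety ℂ}
    (hX : Domination.AVDominatedBy X (⨁ fun l => ((κ l).elim E fun x => B x.1 x.2 : AbelianVariety ℂ))) : HodgeConjectureFor X.dim X.X :=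
  Domination.hodgeConjectureFor_of_avDominatedBy
    (hodgeConjectureFor_biproduct_sigma_of_dihedralDecics' hM6 h2 iK hdeg hB hE hΦ₀ hcnt hc h20 hns hfree hiso κ) hX

end Grouped

end Summit.HodgeConjecture.CorCM.MultiFieldWeil

end
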